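import Mathlib.CategoryTheory.CofilteredSystem
import Mathlib.CategoryTheory.Functor.OfSequence
import Mathlib.Data.Set.Finite.Basic
import Mathlib.Data.Fintype.Pi
import HarnessLib

/-!
# Kőnig's lemma for a DOUBLE tower of finite sets (two commuting families of transition maps)

Topic `NumberTheory/EllipticCurves`; namespace `Literature.NumberTheory.EllipticCurves.DoubleTower`.  THEOREMS ONLY (no
definition, no named fact, no `sorry`, no instance).  GENERIC form of the tree's
`Kato2004.exists_compatible_of_finite_nonempty` (`Kato2004/IwasawaH1TowerLimitProofs.lean` §4, which is the same argument
for the specific tower `H¹(ℚ_n, W[p^k])`): for ANY double-indexed family of types `L n k` with transition maps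
`redk : L n (k+1) → L n k`, `redn : L (n+1) k → L n k` that COMMUTE, and FINITE subsets `S n k ⊆ L n k` mapped into each other by
both transitions with the diagonal sets `S j j` non-empty, there is a DOUBLY COMPATIBLE family `c n k ∈ S n k`.  Proof
(adapted from the tree file named above): the families on the squares `[0, j]²` that are compatible inside the square form an
inverse system (restriction) of finite non-empty sets — non-empty by pushing an element of `S j j` down the square, which uses the
commutation —, and a section of this `ℕ`-indexed inverse system (Mathlib's `nonempty_sections_of_finite_inverse_system`) is a
compatible family on all of `ℕ × ℕ`.

* `exists_compatible_of_finite_nonempty` — the statement above (the types are assumed non-empty, which for additive groups is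
  automatic);
* `exists_compatible_of_finite` — the same for finite level types, with predicates `Q n k` in place of the finite sets.

Consumer: the (α3) ROW-2 construction of cell `bsd-print-cf2` (memo `ROW2-SPEC-w6g8.md` (R2-9)): lifting a family of level classes
compatible MODULO finite subgroups to an element of a pinned double limit `lim←_{n,k} H¹(G_S(K̃_n), μ_{2^k} ⊗ θ)`. HONEST FRAMING: pure
set-theoretic compactness; nothing about BSD.

References: D. Kőnig (1927) / N. Bourbaki, *Topologie générale* I §9.6 Prop. 8; K. Rubin, *Euler Systems* (2000) App. B §B.3;
J. Neukirch, A. Schmidt, K. Wingberg, *Cohomology of Number Fields* (2008) Cor. (2.7.6) (Mittag-Leffler for finite systems).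
-/

noncomputable section

open CategoryTheory

universe u

namespace Literature.NumberTheory.EllipticCurves.DoubleTower

-- adapted from Literature/NumberTheory/EllipticCurves/Kato2004/IwasawaH1TowerLimitProofs.lean §4 (`exists_compatible_of_finite_nonempty`)
/-- **Kőnig's lemma for a double tower.** Types `L n k` (non-empty), commuting transitions `redk`, `redn`, finite sets `S n k` stable under
both transitions with `S j j ≠ ∅`: there is a family `c n k ∈ S n k` with `redk (c n (k+1)) = c n k` and `redn (c (n+1) k) = c n k`.
[cite: Rubin2000, App. B §B.3 (p. 228)] [cite: NeukirchSchmidtWingberg2008, Ch. II §7 Cor. (2.7.6)] -/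
theorem exists_compatible_of_finite_nonempty {L : ℕ → ℕ → Type u} [∀ n k, Nonempty (L n k)]
    (redk : ∀ n k : ℕ, L n (k + 1) → L n k) (redn : ∀ n k : ℕ, L (n + 1) k → L n k)
    (hcomm : ∀ (n k : ℕ) (x : L (n + 1) (k + 1)), redk n k (redn n (k + 1) x) = redn n k (redk (n + 1) k x))
    (S : ∀ n k : ℕ, Set (L n k)) (hfin : ∀ n k, (S n k).Finite) (hne : ∀ j, (S j j).Nonempty)
    (hSk : ∀ n k, ∀ x ∈ S n (k + 1), redk n k x ∈ S n k) (hSn : ∀ n k, ∀ x ∈ S (n + 1) k, redn n k x ∈ S n k) :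
    ∃ c : ∀ n k : ℕ, L n k,
      (∀ n k, c n k ∈ S n k) ∧ (∀ n k, redk n k (c n (k + 1)) = c n k) ∧ (∀ n k, redn n k (c (n + 1) k) = c n k) := by
  classical
  -- a junk value outside the squares
  let dflt : ∀ n k : ℕ, L n k := fun n k ↦ Classical.arbitrary (L n k)
  -- truncated compatible families on the square `[0, j]²` (junk outside the square)
  let P : ℕ → (∀ n k : ℕ, L n k) → Prop := fun j c ↦
    (∀ n k, n ≤ j → k ≤ j → c n k ∈ S n k) ∧
    (∀ n k, n + 1 ≤ j → k ≤ j → redn n k (c (n + 1) k) = c n k) ∧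
    (∀ n k, n ≤ j → k + 1 ≤ j → redk n k (c n (k + 1)) = c n k) ∧
    (∀ n k, ¬ (n ≤ j ∧ k ≤ j) → c n k = dflt n k)
  let X : ℕ → Type u := fun j ↦ {c // P j c}
  -- non-emptiness: push an element of `S j j` down the square
  have hX : ∀ j, Nonempty (X j) := by
    intro j
    obtain ⟨s, hs⟩ := hne j
    -- downward in `k` at layer `j`
    let r : ∀ k, k ≤ j → L j k := fun k hk ↦
      Nat.decreasingInduction (motive := fun k _ ↦ L j k) (fun k _ x ↦ redk j k x) s hk
    have hr_self : r j le_rfl = s := Nat.decreasingInduction_self _ _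
    have hr_succ : ∀ k (hk : k + 1 ≤ j), r k (Nat.le_of_succ_le hk) = redk j k (r (k + 1) hk) :=
      fun k hk ↦ Nat.decreasingInduction_succ_left _ _ hk _
    have hr_mem : ∀ d k (hk : k ≤ j), k + d = j → r k hk ∈ S j k := by
      intro d
      induction d with
      | zero =>
          intro k hk hkj
          obtain rfl : j = k := by omega
          rw [hr_self]
          exact hs
      | succ d ih =>
          intro k hk hkj
          have hk1 : k + 1 ≤ j := by omega
          rw [hr_succ k hk1]
          exact hSk j k _ (ih (k + 1) hk1 (by omega))
    -- then downward in `n`, for each `k ≤ j`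
    let cc : ∀ k, k ≤ j → ∀ n, n ≤ j → L n k := fun k hk n hn ↦
      Nat.decreasingInduction (motive := fun n _ ↦ L n k) (fun n _ x ↦ redn n k x) (r k hk) hn
    have hcc_self : ∀ k (hk : k ≤ j), cc k hk j le_rfl = r k hk := fun k hk ↦ Nat.decreasingInduction_self _ _
    have hcc_succ : ∀ k (hk : k ≤ j) n (hn : n + 1 ≤ j),
        cc k hk n (Nat.le_of_succ_le hn) = redn n k (cc k hk (n + 1) hn) :=
      fun k hk n hn ↦ Nat.decreasingInduction_succ_left _ _ hn _
    have hcc_mem : ∀ k (hk : k ≤ j) d n (hn : n ≤ j), n + d = j → cc k hk n hn ∈ S n k := by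
      intro k hk d
      induction d with
      | zero =>
          intro n hn hnj
          obtain rfl : j = n := by omega
          rw [hcc_self]
          exact hr_mem (j - k) k hk (by omega)
      | succ d ih =>
          intro n hn hnj
          have hn1 : n + 1 ≤ j := by omega
          rw [hcc_succ k hk n hn1]
          exact hSn n k _ (ih (n + 1) hn1 (by omega))
    have hcc_red : ∀ k (hk : k + 1 ≤ j) d n (hn : n ≤ j), n + d = j →
        redk n k (cc (k + 1) hk n hn) = cc k (Nat.le_of_succ_le hk) n hn := by
      intro k hk d
      induction d with
      | zero =>
          intro n hn hnj
          obtain rfl : j = n := by omega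
          rw [hcc_self, hcc_self]
          exact (hr_succ k hk).symm
      | succ d ih =>
          intro n hn hnj
          have hn1 : n + 1 ≤ j := by omega
          rw [hcc_succ (k + 1) hk n hn1, hcc_succ k (Nat.le_of_succ_le hk) n hn1, hcomm, ih (n + 1) hn1 (by omega)]
    let c₀ : ∀ n k : ℕ, L n k := fun n k ↦ if h : n ≤ j ∧ k ≤ j then cc k h.2 n h.1 else dflt n k
    refine ⟨⟨c₀, ?_, ?_, ?_, ?_⟩⟩
    · intro n k hn hk
      simp only [c₀, dif_pos (And.intro hn hk)]
      exact hcc_mem k hk (j - n) n hn (by omega)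
    · intro n k hn hk
      simp only [c₀, dif_pos (And.intro hn hk), dif_pos (And.intro (Nat.le_of_succ_le hn) hk)]
      exact (hcc_succ k hk n hn).symm
    · intro n k hn hk
      simp only [c₀, dif_pos (And.intro hn hk), dif_pos (And.intro hn (Nat.le_of_succ_le hk))]
      exact hcc_red k hk (j - n) n hn (by omega)
    · intro n k h
      simp only [c₀, dif_neg h]
  -- the restriction maps `[0, j+1]² → [0, j]²`
  let trunc : ℕ → (∀ n k : ℕ, L n k) → (∀ n k : ℕ, L n k) := fun j c n k ↦ if n ≤ j ∧ k ≤ j then c n k else dflt n k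
  have htruncP : ∀ (j : ℕ) (c : X (j + 1)), P j (trunc j c.1) := by
    intro j c
    obtain ⟨h1, h2, h3, -⟩ := c.2
    refine ⟨?_, ?_, ?_, ?_⟩
    · intro n k hn hk
      simp only [trunc, if_pos (And.intro hn hk)]
      exact h1 n k (by omega) (by omega)
    · intro n k hn hk
      simp only [trunc, if_pos (And.intro hn hk), if_pos (And.intro (Nat.le_of_succ_le hn) hk)]
      exact h2 n k (by omega) (by omega)
    · intro n k hn hk
      simp only [trunc, if_pos (And.intro hn hk), if_pos (And.intro hn (Nat.le_of_succ_le hk))]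
      exact h3 n k (by omega) (by omega)
    · intro n k h
      simp only [trunc, if_neg h]
  let f₀ : ∀ j, X (j + 1) → X j := fun j c ↦ ⟨trunc j c.1, htruncP j c⟩
  let f : ∀ j, X (j + 1) ⟶ X j := fun j ↦ TypeCat.ofHom (f₀ j)
  let F : ℕᵒᵖ ⥤ Type u := Functor.ofOpSequence (X := X) f
  haveI : ∀ j : ℕᵒᵖ, Finite (F.obj j) := fun j ↦ by
    change Finite (X j.unop)
    haveI : ∀ n k, Finite (S n k) := fun n k ↦ (hfin n k).to_subtype
    let ι : X j.unop → (∀ a b : Fin (j.unop + 1), S a b) := fun c a b ↦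
      ⟨c.1 a b, c.2.1 a b (Nat.le_of_lt_succ a.2) (Nat.le_of_lt_succ b.2)⟩
    refine Finite.of_injective ι fun c c' h ↦ Subtype.ext (funext fun n ↦ funext fun k ↦ ?_)
    by_cases hnk : n ≤ j.unop ∧ k ≤ j.unop
    · have h' := congrArg
        (fun g : (∀ a b : Fin (j.unop + 1), S a b) ↦
          ((g ⟨n, Nat.lt_succ_of_le hnk.1⟩ ⟨k, Nat.lt_succ_of_le hnk.2⟩ : S n k) : L n k)) h
      exact h'
    · rw [c.2.2.2.2 n k hnk, c'.2.2.2.2 n k hnk]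
  haveI : ∀ j : ℕᵒᵖ, Nonempty (F.obj j) := fun j ↦ hX j.unop
  -- Kőnig
  obtain ⟨u, hu⟩ := nonempty_sections_of_finite_inverse_system F
  have hstep : ∀ j n k, n ≤ j → k ≤ j →
      ((u (Opposite.op (j + 1)) : X (j + 1)).1 n k = (u (Opposite.op j) : X j).1 n k) := by
    intro j n k hn hk
    have h := hu (homOfLE (Nat.le_add_right j 1)).op
    rw [Functor.ofOpSequence_map_homOfLE_succ] at h
    have h' : (if n ≤ j ∧ k ≤ j then (u (Opposite.op (j + 1)) : X (j + 1)).1 n k else dflt n k) =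
        (u (Opposite.op j) : X j).1 n k :=
      congrArg (fun c : X j ↦ c.1 n k) h
    rwa [if_pos (And.intro hn hk)] at h'
  have hstable : ∀ j j', j ≤ j' → ∀ n k, n ≤ j → k ≤ j →
      ((u (Opposite.op j') : X j').1 n k = (u (Opposite.op j) : X j).1 n k) := by
    intro j j' hjj'
    induction j', hjj' using Nat.le_induction with
    | base => intro n k _ _; rfl
    | succ j' hjj' ih =>
        intro n k hn hk
        rw [hstep j' n k (hn.trans hjj') (hk.trans hjj'), ih n k hn hk]
  refine ⟨fun n k ↦ (u (Opposite.op (n + k)) : X (n + k)).1 n k, fun n k ↦ ?_, fun n k ↦ ?_, fun n k ↦ ?_⟩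
  · exact (u (Opposite.op (n + k)) : X (n + k)).2.1 n k (Nat.le_add_right n k) (Nat.le_add_left k n)
  · rw [(u (Opposite.op (n + (k + 1))) : X (n + (k + 1))).2.2.2.1 n k (Nat.le_add_right n (k + 1))
      (Nat.le_add_left (k + 1) n)]
    exact hstable (n + k) (n + (k + 1)) (by omega) n k (Nat.le_add_right n k) (Nat.le_add_left k n)
  · rw [(u (Opposite.op (n + 1 + k)) : X (n + 1 + k)).2.2.1 n k (Nat.le_add_right (n + 1) k)
      (Nat.le_add_left k (n + 1))]
    exact hstable (n + k) (n + 1 + k) (by omega) n k (Nat.le_add_right n k) (Nat.le_add_left k n)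

/-- **Kőnig for a double tower with FINITE LEVELS, predicate form.** If every level type `L n k` is finite, `Q n k` are predicates stable
under both (commuting) transitions and satisfiable on the diagonal, then some doubly compatible family satisfies `Q` everywhere
(`exists_compatible_of_finite_nonempty` with `S n k := {x ∣ Q n k x}`). Typical use: `Q n k x := «x ≡ y n k modulo a subgroup C n k»`
— a family of level classes compatible MODULO the `C`'s lifts to a genuinely compatible family. [cite: Rubin2000, App. B §B.3 (p. 228)] -/
theorem exists_compatible_of_finite {L : ℕ → ℕ → Type u} [∀ n k, Nonempty (L n k)] [∀ n k, Finite (L n k)]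
    (redk : ∀ n k : ℕ, L n (k + 1) → L n k) (redn : ∀ n k : ℕ, L (n + 1) k → L n k)
    (hcomm : ∀ (n k : ℕ) (x : L (n + 1) (k + 1)), redk n k (redn n (k + 1) x) = redn n k (redk (n + 1) k x))
    (Q : ∀ n k : ℕ, L n k → Prop) (hne : ∀ j, ∃ x : L j j, Q j j x)
    (hQk : ∀ n k (x : L n (k + 1)), Q n (k + 1) x → Q n k (redk n k x)) (hQn : ∀ n k (x : L (n + 1) k), Q (n + 1) k x → Q n k (redn n k x)) :
    ∃ c : ∀ n k : ℕ, L n k,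
      (∀ n k, Q n k (c n k)) ∧ (∀ n k, redk n k (c n (k + 1)) = c n k) ∧ (∀ n k, redn n k (c (n + 1) k) = c n k) := by
  obtain ⟨c, hc, hk, hn⟩ := exists_compatible_of_finite_nonempty redk redn hcomm (fun n k ↦ {x | Q n k x})
    (fun n k ↦ Set.toFinite _) (fun j ↦ hne j) (fun n k x hx ↦ hQk n k x hx) (fun n k x hx ↦ hQn n k x hx)
  exact ⟨c, hc, hk, hn⟩

end Literature.NumberTheory.EllipticCurves.DoubleTower

end
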